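import Mathlib
import Summits.ValiantsHypothesis.ValiantsHypothesis.Theorems.BarrierLeverNaturalProofsSeparateVNPSignSliceAsPrintedBounds
import HarnessLib

/-!
# Item `BarrierLever.NaturalProofsSeparateVNP` (stmt-ValiantsHypothesis-18972), SIGN SLICE —
# part 15: the pigeonhole threshold for the AS-PRINTED CKRST 2020 Thm. 1.3 (`VNP` slice)

The `VNP` analogue of part 10: with `N = C(n + d, d)`, `d = n^c`, size schedule
`t = n^{⌊log₂ n⌋}` and the hitting-point coordinate bound of part 14,
`B = (t+1) (4 t N + 1)^(9376 (n+3t+4)^21) · d + 1`, the inequality `N · B^d + 1 < 2^N` holds for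
`n ≥ n₀(c)` (`VNPBounds.threshold`). Same bookkeeping in `E = (c+1)(⌊log₂ n⌋+1)²` as part 10.

References: [ChatterjeeKumarRamyaSaptharishiTengse2020] §5 (Thm. 1.3).
-/

-- layout Summits/ValiantsHypothesis/ValiantsHypothesis forces the duplicated namespace component
set_option linter.dupNamespace false

namespace Summit.ValiantsHypothesis.ValiantsHypothesis.Theorems.BarrierLever.NaturalProofsSeparateVNP

open Summit.ValiantsHypothesis.ValiantsHypothesis.Theorems.BarrierLever.SuccinctHittingSetsForVP
open AsPrintedBounds

namespace VNPBounds

/-- The parameter count of part 13: `9376 (n + 3t + 4)^21 ≤ 2^(21 E + 77)`. [folklore] -/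
theorem params_le {E n t : ℕ} (hn : n ≤ 2 ^ E) (ht : t ≤ 2 ^ E) :
    9376 * (n + t + t + t + 4) ^ 21 ≤ 2 ^ (21 * E + 77) := by
  have h4 : 4 ≤ 4 * 2 ^ E := by have := Nat.one_le_two_pow (n := E); omega
  have hX : n + t + t + t + 4 ≤ 2 ^ (E + 3) := by rw [pow_add]; norm_num; omega
  have h1 : (n + t + t + t + 4) ^ 21 ≤ 2 ^ ((E + 3) * 21) := pow_le_two_pow hX 21
  have h2 : (9376 : ℕ) ≤ 2 ^ 14 := by norm_num
  calc 9376 * (n + t + t + t + 4) ^ 21 ≤ 2 ^ 14 * 2 ^ ((E + 3) * 21) := Nat.mul_le_mul h2 h1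
    _ = 2 ^ (21 * E + 77) := by rw [← pow_add]; ring_nf

/-- The base: `4 t C(n+d,d) + 1 ≤ 2^(E + 3 + 2^(E+1))`. [folklore] -/
theorem base_le {E n d t : ℕ} (hn : n ≤ 2 ^ E) (hd : d ≤ 2 ^ E) (ht : t ≤ 2 ^ E) :
    4 * t * (n + d).choose d + 1 ≤ 2 ^ (E + 3 + 2 ^ (E + 1)) := by
  have hC : (n + d).choose d ≤ 2 ^ (2 ^ (E + 1)) :=
    (Nat.choose_le_two_pow _ _).trans (two_pow_mono (add_le_two_pow hn hd))
  have h4t : 4 * t ≤ 2 ^ (E + 2) := by rw [pow_add]; omega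
  have h := succ_le_two_pow (mul_le_two_pow h4t hC)
  exact h.trans (two_pow_mono (le_of_eq (by ring)))

/-- **The pigeonhole inequality, abstract form (`VNP` slice).** With `n, d, t ≤ 2^E`, `E ≥ 2`,
`p ≤ 9376 (n+3t+4)^21` and `N = C(n+d, d)`:
`N · ((t+1) (4 t N + 1)^p · d + 1)^d + 1 ≤ 2^(2^(23 E + 81))`. [folklore] -/
theorem main_le {E n d t p : ℕ} (hn : n ≤ 2 ^ E) (hd : d ≤ 2 ^ E) (ht : t ≤ 2 ^ E) (hE : 2 ≤ E)
    (hp : p ≤ 9376 * (n + t + t + t + 4) ^ 21) :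
    (n + d).choose d * ((t + 1) * (4 * t * (n + d).choose d + 1) ^ p * d + 1) ^ d + 1 ≤
      2 ^ (2 ^ (23 * E + 81)) := by
  have hbase := base_le hn hd ht
  have hG : E + 3 + 2 ^ (E + 1) ≤ 2 ^ (E + 2) := (AsPrintedBounds.base_le hn hd (by omega)).2
  set G := E + 3 + 2 ^ (E + 1) with hGdef
  have hp' : p ≤ 2 ^ (21 * E + 77) := hp.trans (params_le hn ht)
  have hZ0 : (4 * t * (n + d).choose d + 1) ^ p ≤ 2 ^ (G * p) := pow_le_two_pow hbase p
  have hGp : G * p ≤ 2 ^ (22 * E + 79) := by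
    calc G * p ≤ 2 ^ (E + 2) * 2 ^ (21 * E + 77) := Nat.mul_le_mul hG hp'
      _ = 2 ^ (22 * E + 79) := by rw [← pow_add]; ring_nf
  have ht1 : t + 1 ≤ 2 ^ (E + 1) := succ_le_two_pow ht
  have hZ : (t + 1) * (4 * t * (n + d).choose d + 1) ^ p ≤ 2 ^ (E + 1 + G * p) :=
    mul_le_two_pow ht1 hZ0
  -- B ≤ 2^H, H = E + 1 + G p + E + 1
  have hB : (t + 1) * (4 * t * (n + d).choose d + 1) ^ p * d + 1 ≤ 2 ^ (E + 1 + G * p + E + 1) :=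
    succ_le_two_pow (mul_le_two_pow hZ hd)
  have hH : E + 1 + G * p + E + 1 ≤ 2 ^ (22 * E + 80) := by
    have h1 : E + 1 + E + 1 ≤ 2 ^ (22 * E + 79) := by
      have := @Nat.lt_two_pow_self (E + 1 + E + 1)
      exact this.le.trans (two_pow_mono (by omega))
    have := add_le_two_pow hGp h1
    rw [pow_succ] at this ⊢; omega
  have hBd : ((t + 1) * (4 * t * (n + d).choose d + 1) ^ p * d + 1) ^ d ≤
      2 ^ ((E + 1 + G * p + E + 1) * d) := pow_le_two_pow hB d
  have hHd : (E + 1 + G * p + E + 1) * d ≤ 2 ^ (23 * E + 80) := by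
    calc (E + 1 + G * p + E + 1) * d ≤ 2 ^ (22 * E + 80) * 2 ^ E := Nat.mul_le_mul hH hd
      _ = 2 ^ (23 * E + 80) := by rw [← pow_add]; ring_nf
  have hN : (n + d).choose d ≤ 2 ^ (2 ^ (E + 1)) :=
    (Nat.choose_le_two_pow _ _).trans (two_pow_mono (add_le_two_pow hn hd))
  have h2E : 2 ^ (E + 1) < 2 ^ (23 * E + 80) := Nat.pow_lt_pow_right (by norm_num) (by omega)
  have hprod : (n + d).choose d * ((t + 1) * (4 * t * (n + d).choose d + 1) ^ p * d + 1) ^ d ≤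
      2 ^ (2 ^ (E + 1) + 2 ^ (23 * E + 80)) :=
    mul_le_two_pow hN (hBd.trans (two_pow_mono hHd))
  have hfin := succ_le_two_pow hprod
  refine hfin.trans (two_pow_mono ?_)
  have : 2 ^ (23 * E + 81) = 2 ^ (23 * E + 80) + 2 ^ (23 * E + 80) := by rw [pow_succ]; ring
  omega

/-- `23 (c+1) (L+1)² + 82 ≤ 2^L` for `L ≥ L₀(c)`. [folklore] -/
theorem exists_log_threshold (c : ℕ) :
    ∃ L₀ : ℕ, ∀ L : ℕ, L₀ ≤ L → 23 * ((c + 1) * (L + 1) ^ 2) + 82 ≤ 2 ^ L := by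
  obtain ⟨L₀, hL₀⟩ := LowDegreeEquations.eventually_mul_pow_le_two_pow (92 * (c + 1) + 82) 2
  refine ⟨max L₀ 1, fun L hL => ?_⟩
  have hL1 : 1 ≤ L := le_of_max_le_right hL
  have h := hL₀ L (le_of_max_le_left hL)
  have hL2 : L ≤ L ^ 2 := Nat.le_self_pow (by norm_num) _
  have h1 : (c + 1) * L ≤ (c + 1) * L ^ 2 := Nat.mul_le_mul_left _ hL2
  have h2 : c + 1 ≤ (c + 1) * L ^ 2 := Nat.le_mul_of_pos_right _ (by positivity)
  have h3 : 1 ≤ L ^ 2 := Nat.one_le_pow _ _ hL1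
  have : 23 * ((c + 1) * (L + 1) ^ 2) + 82 ≤ (92 * (c + 1) + 82) * L ^ 2 := by
    have expand : 23 * ((c + 1) * (L + 1) ^ 2) + 82 =
        23 * ((c + 1) * L ^ 2) + 46 * ((c + 1) * L) + 23 * (c + 1) + 82 := by ring
    have expand2 : (92 * (c + 1) + 82) * L ^ 2 = 92 * ((c + 1) * L ^ 2) + 82 * L ^ 2 := by ring
    rw [expand, expand2]
    linarith
  exact this.trans h

/-- **Threshold for the as-printed `VNP` construction.** For `n ≥ n₀(c)`: `n ≥ 6` and, with
`d = n^c`, `t = n^{⌊log₂ n⌋}`, `N = C(n+d, d)`, `B = (t+1)(4 t N + 1)^(9376 (n+3t+4)^21) · d + 1`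
(the hitting bound of part 14): `N · B^d + 1 < 2^N`. [cite: ChatterjeeKumarRamyaSaptharishiTengse2020, §5] -/
theorem threshold (c : ℕ) (hc : 1 ≤ c) : ∃ n₀ : ℕ, ∀ n : ℕ, n₀ ≤ n → 6 ≤ n ∧
    (n + n ^ c).choose (n ^ c) *
        ((n ^ Nat.log 2 n + 1) *
            (4 * n ^ Nat.log 2 n * (n + n ^ c).choose (n ^ c) + 1) ^
              (9376 * (n + n ^ Nat.log 2 n + n ^ Nat.log 2 n + n ^ Nat.log 2 n + 4) ^ 21) *
            n ^ c + 1) ^ (n ^ c) + 1 <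
      2 ^ (n + n ^ c).choose (n ^ c) := by
  obtain ⟨L₀, hL₀⟩ := exists_log_threshold c
  refine ⟨max (2 ^ L₀) 6, fun n hn => ?_⟩
  have hn6 : 6 ≤ n := le_of_max_le_right hn
  have hnL : 2 ^ L₀ ≤ n := le_of_max_le_left hn
  refine ⟨hn6, ?_⟩
  set L := Nat.log 2 n with hLdef
  set E := (c + 1) * (L + 1) ^ 2 with hEdef
  have hL0 : L₀ ≤ L := by
    rw [hLdef]; exact Nat.le_log_of_pow_le (by norm_num) hnL
  have hkey := hL₀ L hL0
  obtain ⟨hnE, hdE, htE⟩ := basic_le c n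
  have hE2 : 2 ≤ E := by rw [hEdef]; nlinarith
  have hmain := main_le (p := 9376 * (n + n ^ Nat.log 2 n + n ^ Nat.log 2 n + n ^ Nat.log 2 n + 4) ^ 21)
    hnE hdE htE hE2 le_rfl
  have hpowL : 2 ^ L ≤ n := by rw [hLdef]; exact Nat.pow_log_le_self 2 (by omega)
  have hexp : 23 * E + 81 < n := by rw [hEdef]; omega
  have hN : 2 ^ n ≤ (n + n ^ c).choose (n ^ c) := by
    have h1 : 2 ^ n ≤ (2 * n).choose n := LowDegreeEquations.two_pow_le_choose (by omega)
    have h2 : (2 * n).choose n ≤ (n + n ^ c).choose n := by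
      refine Nat.choose_le_choose n ?_
      have : n ≤ n ^ c := by
        calc n = n ^ 1 := (pow_one n).symm
          _ ≤ n ^ c := Nat.pow_le_pow_right (by omega) hc
      omega
    have h3 : (n + n ^ c).choose n = (n + n ^ c).choose (n ^ c) := by
      rw [Nat.choose_symm_add]
    rw [← h3]; exact h1.trans h2
  refine lt_of_le_of_lt hmain ?_
  calc 2 ^ (2 ^ (23 * E + 81)) < 2 ^ (2 ^ n) :=
        Nat.pow_lt_pow_right (by norm_num) (Nat.pow_lt_pow_right (by norm_num) hexp)
    _ ≤ 2 ^ (n + n ^ c).choose (n ^ c) := two_pow_mono hN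

end VNPBounds

end Summit.ValiantsHypothesis.ValiantsHypothesis.Theorems.BarrierLever.NaturalProofsSeparateVNP
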